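import Summits.QuantumAdvantage.QuantumAdvantage.Theses.MobiusLadder
import Literature.Computability.Complexity.ACRealizeOver
import Summits.QuantumAdvantage.QuantumAdvantage.Theorems.MobiusLadderLiouvilleNotTC0
import Summits.QuantumAdvantage.QuantumAdvantage.Theorems.MobiusLadderLiouvilleOrthogonalTC0Defs
import Summits.QuantumAdvantage.QuantumAdvantage.Theorems.MobiusLadderLiouvilleOrthogonalTC0StubXor
import Summits.QuantumAdvantage.QuantumAdvantage.Theorems.MobiusLadderLiouvilleOrthogonalTC0StubCells
import HarnessLib

/-!
# Crux `MobiusLadder.LiouvilleOrthogonalTC0` (stmt-QuantumAdvantage-1393), line `Sketch`: the transfer,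
part 1 — the per-cell XOR bound

The heart of the multiplicative XOR ladder (card `multiplicative-xor-ladder`): on a FULL cell
`{s} × ∏ᵢ Uᵢ` of the factorisation of `N < 2ⁿ` into its smooth part `s` and its prime-window pieces,
the correlation of `λ` with a test `sgn ∘ g ∘ bits` is at most `(kγ + (1-δ)^k₁) · #cell` as soon as
`k₁` coordinates carry a `γ`-hard-core measure of density `δ` for `[λ = -1]` against the DILATES of
`g` (`u ↦ g(bits(u·R))`): the XOR is supplied by complete multiplicativity
(`λ(s∏tᵢ) = λ(s)∏λ(tᵢ)`), the product structure by the landed cell bijection `stub_cells`, the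
amplification by the landed abstract XOR lemma `stub_xor`.

* `Transfer.cell_xor_bound` — the XOR bound on a product of pieces for given measures;
* `cell_full_bound` — the registered sub-goal: hard-core measures on the qualifying coordinates
  (hypothesis `hmeas`, discharged in part 3 from `LocalPieceHardness` + `stub_hardcore`), zero
  measure elsewhere, `∏(1 - δᵢ) ≤ (1-δ)^k₁`.
-/

set_option linter.dupNamespace false -- D-0017: single-problem summit ⇒ `QuantumAdvantage.QuantumAdvantage` by design

noncomputable section

namespace Summit.QuantumAdvantage.QuantumAdvantage.Theorems.LiouvilleOrthogonalTC0

open Filter Finset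
open Literature.Computability.Complexity
open Literature.Probability.RandomGraphs.LowDegree (sgn)
open Summit.QuantumAdvantage.QuantumAdvantage.Theorems.MobiusLadder (abs_cast_liouville_le_one)

namespace Transfer

/-! ### Multiplicativity and signs -/

/-- `λ` of a finite product is the product of the `λ`'s (complete multiplicativity). -/
theorem liouville_finset_prod {ι : Type*} (S : Finset ι) (f : ι → ℕ) :
    ArithmeticFunction.liouville (∏ i ∈ S, f i) = ∏ i ∈ S, ArithmeticFunction.liouville (f i) := by
  classical
  induction S using Finset.induction_on with
  | empty => simp [ArithmeticFunction.liouville_apply_one]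
  | insert a S ha ih =>
    rw [Finset.prod_insert ha, Finset.prod_insert ha, ArithmeticFunction.liouville_apply_mul, ih]

/-- `|sgn b| ≤ 1`. -/
theorem abs_sgn_le_one (b : Bool) : |sgn b| ≤ 1 := by
  cases b <;> simp [sgn]

/-- For `u ≠ 0`: `λ(u) · sgn b = +1` if `b = [λ(u) = -1]` and `-1` otherwise. -/
theorem lam_mul_sgn (u : ℕ) (hu : u ≠ 0) (b : Bool) :
    ((ArithmeticFunction.liouville u : ℤ) : ℝ) * sgn b = if b = lamBit u then 1 else -1 := by
  have h := ArithmeticFunction.liouville_apply hu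
  have hpm : ArithmeticFunction.liouville u = 1 ∨ ArithmeticFunction.liouville u = -1 := by
    rw [h]; exact (neg_one_pow_eq_or ℤ _).symm.imp id id |>.symm
  unfold lamBit
  rcases hpm with h1 | h1 <;> cases b <;> simp [h1, sgn]

/-- The dilated test read through `bits`: for `u < 2ⁿ`,
`(i ↦ testBit ((Σⱼ (bits n u j) 2ʲ) · R) i) = bits n (u · R)`. -/
theorem dilate_bits (n u R : ℕ) (hu : u < 2 ^ n) :
    (fun i : Fin n => Nat.testBit ((∑ j : Fin n, ((bits n u) j).toNat * 2 ^ (j : ℕ)) * R) i) =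
      bits n (u * R) := by
  have h : (∑ j : Fin n, ((bits n u) j).toNat * 2 ^ (j : ℕ)) = u := by
    have := ofBits_bits n u
    unfold ofBits at this
    rw [this, Nat.mod_eq_of_lt hu]
  rw [h]; rfl

/-- **Per-cell XOR bound.** On a full cell `{s₀} × ∏ᵢ Uᵢ` (pieces `Uᵢ` of numbers `0 < u < 2ⁿ`),
for a test `g` whose dilates `x ↦ g(bits n (ofBits x · R))` all lie in a class against which each
measure `Mᵢ` (valued in `[0,1]`) is `γ`-hard-core on `Uᵢ` for `f = [λ = -1]`, the correlation of
`λ` with `sgn ∘ g ∘ bits` over the cell is at most `(kγ + ∏ᵢ (1 - δᵢ)) · #cell`. (`stub_xor` with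
the XOR supplied by multiplicativity; the dilation by `stub_dilate`; `ofBits ∘ bits = id` below `2ⁿ`.) -/
theorem cell_xor_bound (n k d' s' : ℕ) (g : (Fin n → Bool) → Bool)
    (hdil : ∀ R : ℕ, ACRealOver tcBasis
      (fun x : Fin n → Bool =>
        g (fun i : Fin n => Nat.testBit ((∑ j : Fin n, (x j).toNat * 2 ^ (j : ℕ)) * R) i)) d' s')
    (U : Fin k → Finset ℕ) (hU : ∀ i, ∀ u ∈ U i, u ≠ 0 ∧ u < 2 ^ n)
    (M : Fin k → ℕ → ℝ) (hM : ∀ i u, 0 ≤ M i u ∧ M i u ≤ 1) (γ : ℝ) (hγ : 0 ≤ γ)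
    (hcoreM : ∀ i : Fin k, ∀ g' : (Fin n → Bool) → Bool, ACRealOver tcBasis g' d' s' →
      |∑ u ∈ U i, M i u * (if g' (bits n u) = lamBit u then (1 : ℝ) else -1)| ≤ γ * #(U i))
    (s₀ : ℕ) :
    |∑ t ∈ Fintype.piFinset U,
        ((ArithmeticFunction.liouville (s₀ * ∏ i, t i) : ℤ) : ℝ) *
          sgn (g (bits n (s₀ * ∏ i, t i)))| ≤
      (k * γ + ∏ i, (1 - (∑ u ∈ U i, M i u) / #(U i))) * ∏ i, (#(U i) : ℝ) := by
  classical
  -- the test on tuples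
  set G : (Fin k → ℕ) → ℝ := fun t => sgn (g (bits n (s₀ * ∏ i, t i))) with hG
  -- multiplicativity: pull out `λ(s₀)`
  have hmul : ∀ t : Fin k → ℕ,
      ((ArithmeticFunction.liouville (s₀ * ∏ i, t i) : ℤ) : ℝ) * sgn (g (bits n (s₀ * ∏ i, t i))) =
        ((ArithmeticFunction.liouville s₀ : ℤ) : ℝ) *
          ((∏ i, ((ArithmeticFunction.liouville (t i) : ℤ) : ℝ)) * G t) := by
    intro t
    rw [ArithmeticFunction.liouville_apply_mul, liouville_finset_prod]
    push_cast
    ring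
  simp_rw [hmul]
  rw [← Finset.mul_sum, abs_mul]
  have hxor := stub_xor k U M (fun u => ((ArithmeticFunction.liouville u : ℤ) : ℝ)) G γ hγ hM
    (fun u => abs_cast_liouville_le_one u) (fun t => abs_sgn_le_one _) ?_
  · calc |((ArithmeticFunction.liouville s₀ : ℤ) : ℝ)| *
          |∑ t ∈ Fintype.piFinset U, (∏ i, ((ArithmeticFunction.liouville (t i) : ℤ) : ℝ)) * G t|
        ≤ 1 * ((k * γ + ∏ i, (1 - (∑ u ∈ U i, M i u) / #(U i))) * ∏ i, (#(U i) : ℝ)) :=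
          mul_le_mul (abs_cast_liouville_le_one s₀) hxor (abs_nonneg _) zero_le_one
      _ = _ := one_mul _
  -- the hard-core hypothesis along each coordinate
  intro i t
  set R : ℕ := s₀ * ∏ j ∈ univ \ {i}, t j with hR
  have hupd : ∀ u : ℕ, s₀ * ∏ j, Function.update t i u j = u * R := by
    intro u
    rw [Finset.prod_update_of_mem (Finset.mem_univ i), hR]
    ring
  -- the dilated test
  set g' : (Fin n → Bool) → Bool := fun x =>
    g (fun i : Fin n => Nat.testBit ((∑ j : Fin n, (x j).toNat * 2 ^ (j : ℕ)) * R) i) with hg'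
  have hg'U : ∀ u ∈ U i, G (Function.update t i u) = sgn (g' (bits n u)) := by
    intro u hu
    simp only [hG, hg']
    rw [hupd u, dilate_bits n u R (hU i u hu).2]
  have hsum : ∑ u ∈ U i, M i u * ((ArithmeticFunction.liouville u : ℤ) : ℝ) * G (Function.update t i u)
      = ∑ u ∈ U i, M i u * (if g' (bits n u) = lamBit u then (1 : ℝ) else -1) := by
    refine Finset.sum_congr rfl fun u hu => ?_
    rw [hg'U u hu, mul_assoc, lam_mul_sgn u (hU i u hu).1]
  rw [hsum]
  exact hcoreM i g' (hdil R)


/-- Products of factors in `[0,1]`, at least `k₁` of which are `≤ 1 - δ`, are `≤ (1-δ)^k₁`. -/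
theorem prod_le_pow_of_card {k k₁ : ℕ} {δ : ℝ} (hδ : 0 ≤ δ) (hδ1 : δ ≤ 1) (f : Fin k → ℝ)
    (P : Fin k → Prop) [DecidablePred P] (h0 : ∀ i, 0 ≤ f i) (h1 : ∀ i, f i ≤ 1)
    (hP : ∀ i, P i → f i ≤ 1 - δ) (hcard : k₁ ≤ #(univ.filter P)) :
    ∏ i, f i ≤ (1 - δ) ^ k₁ := by
  calc ∏ i, f i ≤ ∏ i, (if P i then (1 - δ) else 1) :=
        Finset.prod_le_prod (fun i _ => h0 i) fun i _ => by
          split_ifs with h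
          · exact hP i h
          · exact h1 i
    _ = (1 - δ) ^ #(univ.filter P) := by
        rw [Finset.prod_ite, Finset.prod_const, Finset.prod_const_one, mul_one]
    _ ≤ (1 - δ) ^ k₁ := pow_le_pow_of_le_one (by linarith) (by linarith) hcard

end Transfer

open Transfer in
/-- **Full-cell bound.** In a full cell with at least `k₁` qualifying coordinates (piece nonempty,
`#U ≥ T`, box above `Yᵢ`), the correlation of `λ` with `sgn ∘ g ∘ bits` over the cell is at most
`(kγ + (1-δ)^k₁) · #cell`: hard-core measures on the qualifying pieces (hypothesis `hmeas`, i.e.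
`LocalPieceHardness` + `stub_hardcore`), zero measure elsewhere, `stub_cells` + `cell_xor_bound`. -/
theorem cell_full_bound (n k k₁ d' s' : ℕ) (hk : 1 ≤ k) (θ γ δ T : ℝ) (hθ : 0 < θ)
    (hγ : 0 ≤ γ) (hδ : 0 < δ) (hδ1 : δ ≤ 1)
    (z : Fin (k + 1) → ℕ) (hz : Monotone z) (htop : 2 ^ n ≤ z (Fin.last k)) (Y : Fin k → ℝ)
    (g : (Fin n → Bool) → Bool)
    (hdil : ∀ R : ℕ, ACRealOver tcBasis
      (fun x : Fin n → Bool =>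
        g (fun i : Fin n => Nat.testBit ((∑ j : Fin n, (x j).toNat * 2 ^ (j : ℕ)) * R) i)) d' s')
    (hmeas : ∀ (i : Fin k) (β : ℕ),
      (pieceSet n (z i.castSucc) (z i.succ) ((1 + θ) ^ β) θ).Nonempty →
      T ≤ #(pieceSet n (z i.castSucc) (z i.succ) ((1 + θ) ^ β) θ) →
      Y i ≤ (1 + θ) ^ β → (1 + θ) ^ (β + 1) ≤ (2 : ℝ) ^ n →
      ∃ M : ℕ → ℝ, (∀ u, 0 ≤ M u ∧ M u ≤ 1) ∧
        δ * #(pieceSet n (z i.castSucc) (z i.succ) ((1 + θ) ^ β) θ) ≤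
          ∑ u ∈ pieceSet n (z i.castSucc) (z i.succ) ((1 + θ) ^ β) θ, M u ∧
        ∀ g' : (Fin n → Bool) → Bool, ACRealOver tcBasis g' d' s' →
          |∑ u ∈ pieceSet n (z i.castSucc) (z i.succ) ((1 + θ) ^ β) θ,
              M u * (if g' (bits n u) = lamBit u then (1 : ℝ) else -1)| ≤
            γ * ∑ u ∈ pieceSet n (z i.castSucc) (z i.succ) ((1 + θ) ^ β) θ, M u)
    (s : ℕ) (hs : IsLocal 0 (z 0) s) (β : Fin k → ℕ)
    (hfull : (s : ℝ) * ∏ i, (1 + θ) ^ (β i + 1) ≤ (2 : ℝ) ^ n)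
    (hqual : k₁ ≤ #(univ.filter fun i : Fin k =>
      (pieceSet n (z i.castSucc) (z i.succ) ((1 + θ) ^ β i) θ).Nonempty ∧
      T ≤ #(pieceSet n (z i.castSucc) (z i.succ) ((1 + θ) ^ β i) θ) ∧ Y i ≤ (1 + θ) ^ β i)) :
    |∑ N ∈ (range (2 ^ n)).filter (fun N => N ≠ 0 ∧ locPart 0 (z 0) N = s ∧
        ∀ i : Fin k, ⌊Real.log (locPart (z i.castSucc) (z i.succ) N) / Real.log (1 + θ)⌋₊ = β i),
        ((ArithmeticFunction.liouville N : ℤ) : ℝ) * sgn (g (bits n N))| ≤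
      (k * γ + (1 - δ) ^ k₁) *
        #((range (2 ^ n)).filter (fun N => N ≠ 0 ∧ locPart 0 (z 0) N = s ∧
          ∀ i : Fin k, ⌊Real.log (locPart (z i.castSucc) (z i.succ) N) / Real.log (1 + θ)⌋₊ = β i)) := by
  classical
  -- the cell and its pieces
  set S := (range (2 ^ n)).filter (fun N => N ≠ 0 ∧ locPart 0 (z 0) N = s ∧
      ∀ i : Fin k, ⌊Real.log (locPart (z i.castSucc) (z i.succ) N) / Real.log (1 + θ)⌋₊ = β i)
    with hSdef
  set U : Fin k → Finset ℕ := fun i => pieceSet n (z i.castSucc) (z i.succ) ((1 + θ) ^ β i) θ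
    with hUdef
  -- every box top is below `2ⁿ` (the cell is full, `s ≥ 1`, the other boxes are `≥ 1`)
  have hs1 : (1 : ℝ) ≤ s := by exact_mod_cast Nat.one_le_iff_ne_zero.mpr hs.1
  have hθ1' : (1 : ℝ) ≤ 1 + θ := by linarith
  have htop_i : ∀ i : Fin k, (1 + θ) ^ (β i + 1) ≤ (2 : ℝ) ^ n := by
    intro i
    have hrest : (1 : ℝ) ≤ ∏ j ∈ univ.erase i, (1 + θ) ^ (β j + 1) := by
      calc (1 : ℝ) = ∏ j ∈ univ.erase i, (1 : ℝ) := Finset.prod_const_one.symm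
        _ ≤ ∏ j ∈ univ.erase i, (1 + θ) ^ (β j + 1) :=
            Finset.prod_le_prod (fun _ _ => zero_le_one) fun j _ => one_le_pow₀ hθ1'
    calc (1 + θ) ^ (β i + 1) = 1 * ((1 + θ) ^ (β i + 1) * 1) := by ring
      _ ≤ (s : ℝ) * ((1 + θ) ^ (β i + 1) * ∏ j ∈ univ.erase i, (1 + θ) ^ (β j + 1)) :=
          mul_le_mul hs1 (mul_le_mul_of_nonneg_left hrest (by positivity)) (by positivity)
            (by positivity)
      _ = (s : ℝ) * ∏ j, (1 + θ) ^ (β j + 1) := by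
          rw [Finset.mul_prod_erase (Finset.univ : Finset (Fin k)) (fun j => (1 + θ) ^ (β j + 1))
            (Finset.mem_univ i)]
      _ ≤ (2 : ℝ) ^ n := hfull
  -- qualifying coordinates and their measures
  have hex : ∀ i : Fin k, ((U i).Nonempty ∧ T ≤ #(U i) ∧ Y i ≤ (1 + θ) ^ β i) →
      ∃ M : ℕ → ℝ, (∀ u, 0 ≤ M u ∧ M u ≤ 1) ∧ δ * #(U i) ≤ ∑ u ∈ U i, M u ∧
      ∀ g' : (Fin n → Bool) → Bool, ACRealOver tcBasis g' d' s' →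
        |∑ u ∈ U i, M u * (if g' (bits n u) = lamBit u then (1 : ℝ) else -1)| ≤ γ * ∑ u ∈ U i, M u :=
    fun i hQ => hmeas i (β i) hQ.1 hQ.2.1 hQ.2.2 (htop_i i)
  let M : Fin k → ℕ → ℝ := fun i =>
    if h : ((U i).Nonempty ∧ T ≤ #(U i) ∧ Y i ≤ (1 + θ) ^ β i) then Classical.choose (hex i h)
    else fun _ => 0
  have hM01 : ∀ i u, 0 ≤ M i u ∧ M i u ≤ 1 := by
    intro i u
    simp only [M]
    split_ifs with h
    · exact (Classical.choose_spec (hex i h)).1 u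
    · exact ⟨le_rfl, zero_le_one⟩
  have hMsum_le : ∀ i, ∑ u ∈ U i, M i u ≤ #(U i) := by
    intro i
    calc ∑ u ∈ U i, M i u ≤ ∑ u ∈ U i, (1 : ℝ) := Finset.sum_le_sum fun u _ => (hM01 i u).2
      _ = #(U i) := by simp
  have hMsum_nn : ∀ i, 0 ≤ ∑ u ∈ U i, M i u := fun i => Finset.sum_nonneg fun u _ => (hM01 i u).1
  have hcoreM : ∀ i : Fin k, ∀ g' : (Fin n → Bool) → Bool, ACRealOver tcBasis g' d' s' →
      |∑ u ∈ U i, M i u * (if g' (bits n u) = lamBit u then (1 : ℝ) else -1)| ≤ γ * #(U i) := by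
    intro i g' hg'
    by_cases h : ((U i).Nonempty ∧ T ≤ #(U i) ∧ Y i ≤ (1 + θ) ^ β i)
    · have hspec := Classical.choose_spec (hex i h)
      have hMi : M i = Classical.choose (hex i h) := by simp only [M, dif_pos h]
      rw [hMi]
      exact (hspec.2.2 g' hg').trans (mul_le_mul_of_nonneg_left (hMi ▸ hMsum_le i) hγ)
    · have hMi : M i = fun _ => 0 := by simp only [M, dif_neg h]
      simp only [hMi, zero_mul, Finset.sum_const_zero, abs_zero]
      exact mul_nonneg hγ (Nat.cast_nonneg _)
  have hMQ : ∀ i, ((U i).Nonempty ∧ T ≤ #(U i) ∧ Y i ≤ (1 + θ) ^ β i) →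
      δ * #(U i) ≤ ∑ u ∈ U i, M i u := by
    intro i h
    have hMi : M i = Classical.choose (hex i h) := by simp only [M, dif_pos h]
    rw [hMi]; exact (Classical.choose_spec (hex i h)).2.1
  -- pieces consist of numbers `0 < u < 2ⁿ`
  have hU : ∀ i, ∀ u ∈ U i, u ≠ 0 ∧ u < 2 ^ n := by
    intro i u hu
    have hu' : u ∈ pieceSet n (z i.castSucc) (z i.succ) ((1 + θ) ^ β i) θ := hu
    simp only [pieceSet, Finset.mem_filter, Finset.mem_range] at hu'
    exact ⟨hu'.2.1.1, hu'.1⟩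
  -- rewrite the cell sum and the cell size over the product of pieces
  have hsum : (∑ N ∈ S, ((ArithmeticFunction.liouville N : ℤ) : ℝ) * sgn (g (bits n N))) =
      ∑ t ∈ Fintype.piFinset U,
        ((ArithmeticFunction.liouville (s * ∏ i, t i) : ℤ) : ℝ) * sgn (g (bits n (s * ∏ i, t i))) :=
    stub_cells n k hk θ hθ z hz htop s hs β hfull
      (fun N => ((ArithmeticFunction.liouville N : ℤ) : ℝ) * sgn (g (bits n N)))
  have hone : (∑ N ∈ S, (1 : ℝ)) = ∑ t ∈ Fintype.piFinset U, (1 : ℝ) :=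
    stub_cells n k hk θ hθ z hz htop s hs β hfull (fun _ => (1 : ℝ))
  have hcard : (#S : ℝ) = ∏ i, (#(U i) : ℝ) := by
    have h1 : (#S : ℝ) = ∑ N ∈ S, (1 : ℝ) := by simp
    rw [h1, hone]
    simp only [Finset.sum_const, nsmul_eq_mul, mul_one, Fintype.card_piFinset]
    push_cast
    rfl
  rw [hsum, hcard]
  -- the XOR bound on the product
  have hxor := cell_xor_bound n k d' s' g hdil U hU M hM01 γ hγ hcoreM s
  have hprod_nn : (0 : ℝ) ≤ ∏ i, (#(U i) : ℝ) := Finset.prod_nonneg fun i _ => Nat.cast_nonneg _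
  refine hxor.trans (mul_le_mul_of_nonneg_right (add_le_add le_rfl ?_) hprod_nn)
  -- `∏ (1 - δᵢ) ≤ (1-δ)^k₁`
  refine prod_le_pow_of_card hδ.le hδ1 (fun i => 1 - (∑ u ∈ U i, M i u) / #(U i))
    (fun i => (U i).Nonempty ∧ T ≤ #(U i) ∧ Y i ≤ (1 + θ) ^ β i) ?_ ?_ ?_ ?_
  · intro i
    rcases (U i).eq_empty_or_nonempty with h | h
    · simp [h]
    · have hpos : (0 : ℝ) < #(U i) := by exact_mod_cast h.card_pos
      rw [sub_nonneg, div_le_one hpos]; exact hMsum_le i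
  · intro i
    rw [sub_le_self_iff]
    exact div_nonneg (hMsum_nn i) (Nat.cast_nonneg _)
  · intro i hQi
    have hpos : (0 : ℝ) < #(U i) := by exact_mod_cast hQi.1.card_pos
    rw [sub_le_sub_iff_left, le_div_iff₀ hpos]
    exact hMQ i hQi
  · convert hqual using 2

end Summit.QuantumAdvantage.QuantumAdvantage.Theorems.LiouvilleOrthogonalTC0
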